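/-
Cell b2b-lgcu-borel (gen 20).  VALUE = THEOREM (a dimension bound), NOT summit progress; the crux
item `SubgroupIdentityDesigns` (stmt-MatrixMultiplication-14079) stays open.
-/
import Mathlib
import Summits.MatrixMultiplication.MatrixMultiplication.Theorems.SubgroupIdentityDesigns.Negative.VectorTransportSpan
import Summits.MatrixMultiplication.MatrixMultiplication.Theorems.SubgroupIdentityDesigns.Negative.LevelOneDim
import Summits.MatrixMultiplication.MatrixMultiplication.Theorems.SubgroupIdentityDesigns.Negative.FreeModuleLaw

/-!
# The `K`-invariants of the level-one space: `dim (F_1)^K ≤ 1 + b (ν_K − 1)` (orbit count)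

Route `LevelGradedCohnUmans`, crux `SubgroupIdentityDesigns` (stmt-MatrixMultiplication-14079), cells
`(m, k) = (m, 1)`; report `run/shared/lean/b2b/levelgraded-cu/ORACLE-g20.md` §G20-2.  VALUE = THEOREM
(the level-one evaluation of the right-hand side of the free-module law `FreeModuleLaw`), NOT summit
progress; the crux item is untouched and remains open.

For a subgroup `K ≤ GL_m(𝔽_p)` let `(F_1)^K = {f ∈ F_1 | f (g k) = f g}` be the right `K`-invariants of
the level-one space (`FreeModuleLaw.invRight`), `Ω = 𝔽_p^m / K` the set of `K`-orbits on vectors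
(`|Ω| = ν_K + 1`, `ν_K` = orbits on `𝔽_p^m ∖ 0`) and `b = #ℙ^{m-1}(𝔽_p)`.

* `finrank_invRight_levelOne_le` — **`dim (F_1)^K + 2b ≤ 1 + |Ω|·b`**, i.e. `dim (F_1)^K ≤ 1 + b(ν_K − 1)`.
  Proof: the right average `A_K f (g) = Σ_{k ∈ K} f (g k)` (`avgR`) is `|K| · f` on `(F_1)^K` and maps
  the vector transports `t_{u,a} = [g u = a]` spanning `F_1` (`VectorTransportSpan`) to orbit
  transports `A_K t_{u,a} = A_K t_{out ω(u), a}` (`avgR_transport_out`), with `t_{u, μ a} = t_{μ⁻¹ u, a}`;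
  so `(F_1)^K` lies in the span of `1` and the `A_K t_{out ω, rep ℓ}` (`ω ≠ {0}`, `ℓ` a line), and the
  COLUMN RELATIONS `Σ_u A_K t_{u,a} = |K| · 1` (`sum_avgR_transport`) delete one orbit `ω₀ ≠ {0}` per
  line.  (The exact value `b(ν_K − 1) − L_K + 2`, `L_K` = `K`-orbits on lines, was confirmed
  numerically in 61 cases, `code/g20/invdim_check.py`; only the displayed bound is proved and used.)
* `card_orbits_mul_card_of_semiregular` — for `K` SEMIREGULAR on `𝔽_p^m ∖ 0` (no `k ≠ 1` fixes a
  non-zero vector), `|Ω| · |K| + 1 = p^m + |K|` (Burnside); hence `|K| · dim (F_1)^K + |K| (b − 1) ≤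
  (p − 1) b²` (`card_mul_finrank_le_of_semiregular`), the input of `SemiregularLaw`.

Sorry-free; standard axioms.
-/

set_option linter.dupNamespace false

noncomputable section

open scoped BigOperators Classical Matrix LinearAlgebra.Projectivization
open Module (finrank)

namespace Summit.MatrixMultiplication.MatrixMultiplication.Theorems.SubgroupIdentityDesigns.Negative
namespace LevelOneInvariantDim

open Summit.MatrixMultiplication.MatrixMultiplication.Theorems.LieRankDesigns.Negative (GLm Mat)
open Summit.MatrixMultiplication.MatrixMultiplication.Theorems.LevelOneGL2Designs.Negative
  (levelSubmodule)
open VectorTransportSpan (levelSubmodule_le_of_transport)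
open FreeModuleLaw (invRight mem_invRight invRight_le)
open LineStabilizer (mulVec_eq_iff)

variable {p m : ℕ}

/-- The vector transport indicator `t_{u,a} : g ↦ [g u = a]`. -/
def transport (u a : Fin m → ZMod p) : GLm p m → ℂ :=
  fun g => if (g : Mat p m) *ᵥ u = a then 1 else 0

/-- Unfolding `transport`. -/
theorem transport_apply (u a : Fin m → ZMod p) (g : GLm p m) :
    transport u a g = if (g : Mat p m) *ᵥ u = a then 1 else 0 := rfl

/-- Scalars move between source and target: `t_{u, μ a} = t_{μ⁻¹ u, a}`. -/
theorem transport_smul (u a : Fin m → ZMod p) (μ : (ZMod p)ˣ) :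
    transport u (μ • a) = transport (μ⁻¹ • u) a := by
  funext g
  simp only [transport_apply]
  have hiff : (g : Mat p m) *ᵥ u = μ • a ↔ (g : Mat p m) *ᵥ (μ⁻¹ • u) = a := by
    rw [Units.smul_def, Units.smul_def, Matrix.mulVec_smul, ← Units.smul_def, ← Units.smul_def,
      inv_smul_eq_iff]
  simp only [hiff]

/-- The transport with source `0` and target `a ≠ 0` vanishes. -/
theorem transport_zero_left {a : Fin m → ZMod p} (ha : a ≠ 0) :
    transport (p := p) (m := m) 0 a = 0 := by
  funext g
  rw [transport_apply, Matrix.mulVec_zero, Pi.zero_apply, if_neg (Ne.symm ha)]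

/-- The orbit quotient `Ω = 𝔽_p^m / K` of a subgroup `K ≤ GL_m(𝔽_p)` acting on vectors. -/
abbrev Ω (K : Subgroup (GLm p m)) := MulAction.orbitRel.Quotient K (Fin m → ZMod p)

/-- The orbit of a vector, as a point of `Ω K`. -/
abbrev orb (K : Subgroup (GLm p m)) (u : Fin m → ZMod p) : Ω K :=
  (Quotient.mk (MulAction.orbitRel K (Fin m → ZMod p)) u : Ω K)

/-- The chosen representative of an orbit is a `K`-translate of any of its vectors. -/
theorem exists_smul_eq_out (K : Subgroup (GLm p m)) (u : Fin m → ZMod p) :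
    ∃ k : K, k • u = (orb K u).out := by
  have h := Quotient.mk_out (s := MulAction.orbitRel K (Fin m → ZMod p)) u
  exact MulAction.mem_orbit_iff.1 (MulAction.orbitRel_apply.1 h)

/-- The representative of the orbit of `0` is `0`. -/
theorem out_orbit_zero (K : Subgroup (GLm p m)) : ((orb K 0).out : Fin m → ZMod p) = 0 := by
  obtain ⟨k, hk⟩ := exists_smul_eq_out K 0
  rw [← hk, smul_zero]

/-- The orbit of `a₀ ≠ 0` is not the orbit of `0`. -/
theorem orb_ne_orb_zero (K : Subgroup (GLm p m)) {a₀ : Fin m → ZMod p} (ha₀ : a₀ ≠ 0) :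
    orb K a₀ ≠ orb K 0 := by
  intro h
  obtain ⟨k, hk⟩ := MulAction.mem_orbit_iff.1 (MulAction.orbitRel_apply.1 (Quotient.exact h))
  rw [smul_zero] at hk
  exact ha₀ hk.symm

variable [hp : Fact p.Prime]

/-- The right `K`-average `A_K f : g ↦ Σ_{k ∈ K} f (g k)`, a linear map. -/
def avgR (K : Subgroup (GLm p m)) : (GLm p m → ℂ) →ₗ[ℂ] (GLm p m → ℂ) where
  toFun f g := ∑ k : K, f (g * k)
  map_add' f f' := by funext g; simp [Finset.sum_add_distrib]
  map_smul' c f := by funext g; simp [Finset.mul_sum]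

/-- Unfolding `avgR`. -/
theorem avgR_apply (K : Subgroup (GLm p m)) (f : GLm p m → ℂ) (g : GLm p m) :
    avgR K f g = ∑ k : K, f (g * k) := rfl

/-- On `K`-invariants the average is multiplication by `|K|`. -/
theorem avgR_of_mem_invRight {K : Subgroup (GLm p m)} {J : Submodule ℂ (GLm p m → ℂ)}
    {f : GLm p m → ℂ} (hf : f ∈ invRight K J) :
    avgR K f = (Fintype.card K : ℂ) • f := by
  funext g
  rw [avgR_apply, Pi.smul_apply]
  have : ∀ k : K, f (g * k) = f g := fun k => (mem_invRight.1 hf).2 k k.2 g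
  simp [this, Finset.sum_const, Finset.card_univ]

/-- A `K`-invariant function lies in any submodule containing its average. -/
theorem mem_of_avgR_mem {K : Subgroup (GLm p m)} {J T : Submodule ℂ (GLm p m → ℂ)}
    {f : GLm p m → ℂ} (hf : f ∈ invRight K J) (hT : avgR K f ∈ T) : f ∈ T := by
  have hK : (Fintype.card K : ℂ) ≠ 0 := by exact_mod_cast Fintype.card_ne_zero
  have : f = (Fintype.card K : ℂ)⁻¹ • avgR K f := by
    rw [avgR_of_mem_invRight hf, smul_smul, inv_mul_cancel₀ hK, one_smul]
  rw [this]
  exact T.smul_mem _ hT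

/-! ## Orbit transports -/

/-- The averaged transport only depends on the `K`-orbit of the source vector:
`A_K t_{k u, a} = A_K t_{u, a}` (`k ∈ K`). -/
theorem avgR_transport_smul (K : Subgroup (GLm p m)) (k₀ : K) (u a : Fin m → ZMod p) :
    avgR K (transport (k₀ • u) a) = avgR K (transport u a) := by
  funext g
  rw [avgR_apply, avgR_apply]
  refine Fintype.sum_equiv (Equiv.mulRight k₀) _ _ fun k => ?_
  have hs : (k₀ • u : Fin m → ZMod p) = ((k₀ : GLm p m) : Mat p m) *ᵥ u := rfl
  simp only [transport_apply, Equiv.coe_mulRight, hs, Matrix.mulVec_mulVec, Subgroup.coe_mul,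
    Units.val_mul, Matrix.mul_assoc]

/-- `A_K t_{u,a} = A_K t_{out ω(u), a}` for the chosen representative of the orbit of `u`. -/
theorem avgR_transport_out (K : Subgroup (GLm p m)) (u a : Fin m → ZMod p) :
    avgR K (transport u a) = avgR K (transport (orb K u).out a) := by
  obtain ⟨k, hk⟩ := exists_smul_eq_out K u
  rw [← hk, avgR_transport_smul]

/-- The transport with target `0` and source `u` is the constant `[u = 0]`. -/
theorem transport_zero_right (u : Fin m → ZMod p) :
    transport (p := p) u 0 = fun _ => if u = 0 then (1 : ℂ) else 0 := by
  funext g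
  simp only [transport_apply]
  have hiff : (g : Mat p m) *ᵥ u = 0 ↔ u = 0 := by
    rw [mulVec_eq_iff, Matrix.mulVec_zero]
  simp only [hiff]

/-- **COLUMN RELATION**: `Σ_{u ∈ 𝔽_p^m} A_K t_{u,a} = |K| · 1` (for each `k`, exactly one `u` has
`g k u = a`). -/
theorem sum_avgR_transport (K : Subgroup (GLm p m)) (a : Fin m → ZMod p) :
    (∑ u : Fin m → ZMod p, avgR K (transport u a)) = fun _ => (Fintype.card K : ℂ) := by
  funext g
  rw [Finset.sum_apply]
  simp only [avgR_apply, transport_apply]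
  rw [Finset.sum_comm]
  have inner : ∀ k : K, (∑ u : Fin m → ZMod p,
      if ((g * (k : GLm p m) : GLm p m) : Mat p m) *ᵥ u = a then (1 : ℂ) else 0) = 1 := by
    intro k
    have hiff : ∀ u : Fin m → ZMod p, ((g * (k : GLm p m) : GLm p m) : Mat p m) *ᵥ u = a ↔
        u = (((g * (k : GLm p m))⁻¹ : GLm p m) : Mat p m) *ᵥ a := fun u => mulVec_eq_iff _ _ _
    simp only [hiff, Finset.sum_ite_eq', Finset.mem_univ, if_true]
  simp only [inner, Finset.sum_const, Finset.card_univ, nsmul_eq_mul, mul_one]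

/-- The number of vectors in an orbit `ω ∈ Ω`. -/
def orbCard (K : Subgroup (GLm p m)) (ω : Ω K) : ℕ :=
  (Finset.univ.filter (fun u : Fin m → ZMod p => orb K u = ω)).card

/-- Orbits are non-empty. -/
theorem orbCard_ne_zero (K : Subgroup (GLm p m)) (ω : Ω K) : orbCard K ω ≠ 0 := by
  rw [orbCard, Finset.card_ne_zero]
  exact ⟨ω.out, by rw [Finset.mem_filter]; exact ⟨Finset.mem_univ _, Quotient.out_eq ω⟩⟩

/-- Regrouping a sum over vectors by `K`-orbits, for a summand constant on orbits. -/
theorem sum_eq_sum_orbits (K : Subgroup (GLm p m)) {M : Type*} [AddCommMonoid M]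
    (Φ : (Fin m → ZMod p) → M) (hΦ : ∀ u, Φ u = Φ (orb K u).out) :
    (∑ u : Fin m → ZMod p, Φ u) = ∑ ω : Ω K, orbCard K ω • Φ ω.out := by
  rw [← Finset.sum_fiberwise Finset.univ (fun u : Fin m → ZMod p => orb K u) Φ]
  refine Finset.sum_congr rfl fun ω _ => ?_
  rw [orbCard, ← Finset.sum_const]
  refine Finset.sum_congr rfl fun u hu => ?_
  rw [Finset.mem_filter] at hu
  rw [hΦ u, hu.2]

/-! ## The spanning set and the dimension bound -/

/-- The generating family: the constant `1` and the orbit transports `A_K t_{out ω, rep ℓ}`,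
`ω ≠ {0}, ω₀`. -/
def gen (K : Subgroup (GLm p m)) {a₀ : Fin m → ZMod p} (_ha₀ : a₀ ≠ 0) :
    Unit ⊕ ({ω : Ω K // ω ≠ orb K 0 ∧ ω ≠ orb K a₀} × ℙ (ZMod p) (Fin m → ZMod p)) →
      (GLm p m → ℂ) :=
  Sum.elim (fun _ _ => 1) (fun x => avgR K (transport x.1.1.out x.2.rep))

/-- Every orbit transport `A_K t_{out ω, rep ℓ}` lies in the span of the generating family (the
deleted orbit `ω₀` is recovered from the column relation). -/
theorem avgR_transport_out_rep_mem (K : Subgroup (GLm p m)) {a₀ : Fin m → ZMod p} (ha₀ : a₀ ≠ 0)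
    (ω : Ω K) (ℓ : ℙ (ZMod p) (Fin m → ZMod p)) :
    avgR K (transport ω.out ℓ.rep) ∈ Submodule.span ℂ (Set.range (gen K ha₀)) := by
  set T := Submodule.span ℂ (Set.range (gen K ha₀)) with hT_def
  have h1 : (fun _ : GLm p m => (1 : ℂ)) ∈ T := Submodule.subset_span ⟨Sum.inl (), rfl⟩
  have hrep : ℓ.rep ≠ 0 := ℓ.rep_nonzero
  have hgen : ∀ ω' : Ω K, ω' ≠ orb K a₀ → avgR K (transport ω'.out ℓ.rep) ∈ T := by
    intro ω' hω'
    by_cases hz : ω' = orb K 0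
    · rw [hz, out_orbit_zero, transport_zero_left hrep, map_zero]
      exact T.zero_mem
    · exact Submodule.subset_span ⟨Sum.inr (⟨ω', hz, hω'⟩, ℓ), rfl⟩
  by_cases hω : ω = orb K a₀
  swap
  · exact hgen ω hω
  have hcol := sum_avgR_transport K ℓ.rep
  rw [sum_eq_sum_orbits K (fun u => avgR K (transport u ℓ.rep))
    (fun u => avgR_transport_out K u ℓ.rep)] at hcol
  rw [← Finset.add_sum_erase _ _ (Finset.mem_univ ω)] at hcol
  have hrest :
      (∑ ω' ∈ Finset.univ.erase ω, orbCard K ω' • avgR K (transport ω'.out ℓ.rep)) ∈ T := by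
    refine Submodule.sum_mem _ fun ω' hω' => Submodule.smul_of_tower_mem _ _ (hgen ω' ?_)
    rw [Finset.mem_erase] at hω'
    rw [← hω]; exact hω'.1
  have hconst : (fun _ : GLm p m => (Fintype.card K : ℂ)) ∈ T := by
    have : (fun _ : GLm p m => (Fintype.card K : ℂ)) = (Fintype.card K : ℂ) • fun _ => (1 : ℂ) := by
      funext g; simp
    rw [this]; exact T.smul_mem _ h1
  have hmain : orbCard K ω • avgR K (transport ω.out ℓ.rep) ∈ T := by
    have heq : orbCard K ω • avgR K (transport ω.out ℓ.rep) =
        (fun _ : GLm p m => (Fintype.card K : ℂ)) -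
          ∑ ω' ∈ Finset.univ.erase ω, orbCard K ω' • avgR K (transport ω'.out ℓ.rep) := by
      rw [← hcol, add_sub_cancel_right]
    rw [heq]
    exact T.sub_mem hconst hrest
  have hcC : (orbCard K ω : ℂ) ≠ 0 := by exact_mod_cast orbCard_ne_zero K ω
  have : avgR K (transport ω.out ℓ.rep) =
      (orbCard K ω : ℂ)⁻¹ • (orbCard K ω • avgR K (transport ω.out ℓ.rep)) := by
    rw [← Nat.cast_smul_eq_nsmul ℂ, smul_smul, inv_mul_cancel₀ hcC, one_smul]
  rw [this]
  exact T.smul_mem _ hmain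

/-- Every averaged transport `A_K t_{u,a}` lies in the span of the generating family. -/
theorem avgR_transport_mem (K : Subgroup (GLm p m)) {a₀ : Fin m → ZMod p} (ha₀ : a₀ ≠ 0)
    (u a : Fin m → ZMod p) :
    avgR K (transport u a) ∈ Submodule.span ℂ (Set.range (gen K ha₀)) := by
  set T := Submodule.span ℂ (Set.range (gen K ha₀)) with hT_def
  have h1 : (fun _ : GLm p m => (1 : ℂ)) ∈ T := Submodule.subset_span ⟨Sum.inl (), rfl⟩
  by_cases ha : a = 0
  · subst ha
    rw [transport_zero_right]
    by_cases hu : u = 0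
    · have : avgR K (fun _ : GLm p m => if u = 0 then (1 : ℂ) else 0) =
          (Fintype.card K : ℂ) • fun _ => (1 : ℂ) := by
        funext g; simp [avgR_apply, hu]
      rw [this]; exact T.smul_mem _ h1
    · have : (fun _ : GLm p m => if u = 0 then (1 : ℂ) else 0) = 0 := by
        funext g; rw [if_neg hu, Pi.zero_apply]
      rw [this, map_zero]; exact T.zero_mem
  · obtain ⟨μ, hμ⟩ := Projectivization.exists_smul_eq_mk_rep (ZMod p) a ha
    have ha' : a = μ⁻¹ • (Projectivization.mk (ZMod p) a ha).rep := by
      rw [← hμ, inv_smul_smul]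
    rw [ha', transport_smul, inv_inv, avgR_transport_out K]
    exact avgR_transport_out_rep_mem K ha₀ _ _

/-- `(F_1)^K` lies in the span of the generating family. -/
theorem invRight_levelOne_le_span (K : Subgroup (GLm p m)) {a₀ : Fin m → ZMod p} (ha₀ : a₀ ≠ 0) :
    invRight K (levelSubmodule p m 1) ≤ Submodule.span ℂ (Set.range (gen K ha₀)) := by
  intro f hf
  have hF : levelSubmodule p m 1 ≤ (Submodule.span ℂ (Set.range (gen K ha₀))).comap (avgR K) :=
    levelSubmodule_le_of_transport fun u a => by
      rw [Submodule.mem_comap]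
      exact avgR_transport_mem K ha₀ u a
  have h := hF (invRight_le K _ hf)
  rw [Submodule.mem_comap] at h
  exact mem_of_avgR_mem hf h

/-- Count of the deleted index set: `#{ω ≠ {0}, ω₀} + 2 ≤ |Ω|`. -/
theorem card_index_add_two_le (K : Subgroup (GLm p m)) {a₀ : Fin m → ZMod p} (ha₀ : a₀ ≠ 0) :
    Fintype.card {ω : Ω K // ω ≠ orb K 0 ∧ ω ≠ orb K a₀} + 2 ≤ Fintype.card (Ω K) := by
  rw [Fintype.card_subtype]
  have hpair : ({orb K 0, orb K a₀} : Finset (Ω K)).card = 2 :=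
    Finset.card_pair (orb_ne_orb_zero K ha₀).symm
  have hdisj : Disjoint (Finset.univ.filter (fun ω : Ω K => ω ≠ orb K 0 ∧ ω ≠ orb K a₀))
      ({orb K 0, orb K a₀} : Finset (Ω K)) := by
    rw [Finset.disjoint_left]
    intro ω hω hmem
    rw [Finset.mem_filter] at hω
    rw [Finset.mem_insert, Finset.mem_singleton] at hmem
    rcases hmem with h | h
    · exact hω.2.1 h
    · exact hω.2.2 h
  have := Finset.card_le_univ ((Finset.univ.filter (fun ω : Ω K => ω ≠ orb K 0 ∧ ω ≠ orb K a₀)) ∪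
    ({orb K 0, orb K a₀} : Finset (Ω K)))
  rw [Finset.card_union_of_disjoint hdisj, hpair] at this
  exact this

/-- **THE INVARIANT DIMENSION BOUND**: `dim (F_1)^K + 2b ≤ 1 + |Ω| · b` (`b = #ℙ^{m-1}(𝔽_p)`,
`|Ω|` = number of `K`-orbits on `𝔽_p^m`, i.e. `dim (F_1)^K ≤ 1 + b (ν_K − 1)`), for `m ≥ 1`
(witnessed by a non-zero vector `a₀`). -/
theorem finrank_invRight_levelOne_le (K : Subgroup (GLm p m)) {a₀ : Fin m → ZMod p}
    (ha₀ : a₀ ≠ 0) :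
    finrank ℂ (invRight K (levelSubmodule p m 1)) + 2 * Nat.card (ℙ (ZMod p) (Fin m → ZMod p)) ≤
      1 + Nat.card (Ω K) * Nat.card (ℙ (ZMod p) (Fin m → ZMod p)) := by
  haveI : Fintype (ℙ (ZMod p) (Fin m → ZMod p)) := Fintype.ofFinite _
  have h1 := Submodule.finrank_mono (invRight_levelOne_le_span K ha₀)
  have h2 : finrank ℂ (Submodule.span ℂ (Set.range (gen K ha₀))) ≤
      Fintype.card (Unit ⊕ ({ω : Ω K // ω ≠ orb K 0 ∧ ω ≠ orb K a₀} ×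
        ℙ (ZMod p) (Fin m → ZMod p))) := finrank_range_le_card _
  rw [Fintype.card_sum, Fintype.card_unit, Fintype.card_prod] at h2
  have h3 := card_index_add_two_le K ha₀
  rw [Nat.card_eq_fintype_card, Nat.card_eq_fintype_card]
  have h4 : (Fintype.card {ω : Ω K // ω ≠ orb K 0 ∧ ω ≠ orb K a₀} + 2) *
      Fintype.card (ℙ (ZMod p) (Fin m → ZMod p)) ≤
        Fintype.card (Ω K) * Fintype.card (ℙ (ZMod p) (Fin m → ZMod p)) :=
    Nat.mul_le_mul_right _ h3
  rw [add_mul] at h4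
  omega

/-! ## Semiregular subgroups: the orbit count -/

/-- **Burnside for a semiregular subgroup**: if no `k ≠ 1` of `K` fixes a non-zero vector, then
`|Ω| · |K| + 1 = p^m + |K|` (`|Ω| − 1 = (p^m − 1)/|K|` orbits on `𝔽_p^m ∖ 0`). -/
theorem card_orbits_mul_card_of_semiregular (K : Subgroup (GLm p m))
    (hK : ∀ k : K, ∀ v : Fin m → ZMod p, v ≠ 0 → k • v = v → k = 1) :
    Nat.card (Ω K) * Nat.card K + 1 = p ^ m + Nat.card K := by
  have hB := MulAction.sum_card_fixedBy_eq_card_orbits_mul_card_group K (Fin m → ZMod p)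
  -- the fixed-point counts: `p^m` at `k = 1`, `1` at `k ≠ 1`
  have hfix1 : Fintype.card (MulAction.fixedBy (Fin m → ZMod p) (1 : K)) = p ^ m := by
    have e : MulAction.fixedBy (Fin m → ZMod p) (1 : K) ≃ (Fin m → ZMod p) :=
      Equiv.subtypeUnivEquiv fun v => by simp
    rw [Fintype.card_congr e, Fintype.card_fun, ZMod.card, Fintype.card_fin]
  have hfix : ∀ k : K, k ≠ 1 → Fintype.card (MulAction.fixedBy (Fin m → ZMod p) k) = 1 := by
    intro k hk
    rw [Fintype.card_eq_one_iff]
    refine ⟨⟨0, by simp [MulAction.mem_fixedBy]⟩, fun v => Subtype.ext ?_⟩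
    by_contra hv
    exact hk (hK k v.1 hv v.2)
  have hsum : (∑ k : K, Fintype.card (MulAction.fixedBy (Fin m → ZMod p) k)) =
      p ^ m + (Fintype.card K - 1) := by
    rw [← Finset.add_sum_erase _ _ (Finset.mem_univ (1 : K)), hfix1]
    congr 1
    rw [Finset.sum_congr rfl fun k hk => hfix k (Finset.ne_of_mem_erase hk), Finset.sum_const,
      Finset.card_erase_of_mem (Finset.mem_univ _), Finset.card_univ, smul_eq_mul, mul_one]
  rw [hsum] at hB
  rw [Nat.card_eq_fintype_card, Nat.card_eq_fintype_card]
  have hpos : 1 ≤ Fintype.card K := Fintype.card_pos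
  have hB' : p ^ m + (Fintype.card K - 1) = Fintype.card (Ω K) * Fintype.card K := hB
  omega

/-- **Semiregular evaluation**: for `K` semiregular on `𝔽_p^m ∖ 0` (`m ≥ 1`),
`|K| · dim (F_1)^K + |K| (b − 1) ≤ (p − 1) b²`, `b = #ℙ^{m-1}(𝔽_p) = (p^m − 1)/(p − 1)`. -/
theorem card_mul_finrank_le_of_semiregular (hm : 1 ≤ m) (K : Subgroup (GLm p m))
    (hK : ∀ k : K, ∀ v : Fin m → ZMod p, v ≠ 0 → k • v = v → k = 1) :
    Nat.card K * finrank ℂ (invRight K (levelSubmodule p m 1)) +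
        Nat.card K * (Nat.card (ℙ (ZMod p) (Fin m → ZMod p)) - 1) ≤
      (p - 1) * Nat.card (ℙ (ZMod p) (Fin m → ZMod p)) ^ 2 := by
  obtain ⟨a₀, ha₀⟩ : ∃ a₀ : Fin m → ZMod p, a₀ ≠ 0 := by
    refine ⟨fun _ => 1, fun h => ?_⟩
    have := congr_fun h ⟨0, hm⟩
    simp at this
  have h1 := finrank_invRight_levelOne_le K ha₀
  have h2 := card_orbits_mul_card_of_semiregular K hK
  have h3 := LevelOneDim.card_proj_mul (p := p) (m := m)
  set b := Nat.card (ℙ (ZMod p) (Fin m → ZMod p)) with hb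
  set d := finrank ℂ (invRight K (levelSubmodule p m 1))
  set n := Nat.card K
  set w := Nat.card (Ω K)
  have hb1 : 1 ≤ b := by
    rw [hb]
    haveI : Nonempty (ℙ (ZMod p) (Fin m → ZMod p)) := ⟨Projectivization.mk (ZMod p) a₀ ha₀⟩
    exact Nat.card_pos
  have hp1 : 1 ≤ p := hp.out.one_lt.le
  have hpm : p ^ m = b * (p - 1) + 1 := by
    have := Nat.one_le_pow m p hp1
    omega
  have hwn : w * n = b * (p - 1) + n := by omega
  have h4 : n * (d + 2 * b) ≤ n * (1 + w * b) := Nat.mul_le_mul_left n h1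
  have h5 : n * (1 + w * b) = n + (b * (p - 1) + n) * b := by rw [← hwn]; ring
  rw [h5] at h4
  zify [hb1, hp1] at h4 ⊢
  linear_combination h4

end LevelOneInvariantDim
end Summit.MatrixMultiplication.MatrixMultiplication.Theorems.SubgroupIdentityDesigns.Negative

end
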